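import Literature.NumberTheory.Rogawski1990.TamagawaSingularKappaSystemCertificate   -- ★ O1 certificate `finPartners_kappaSystem_of_reference_of_archSign` (whole-sentence) + its §1 helpers + every currency it reads
import HarnessLib

/-!
# [Rogawski1990 §8.2 Prop. 8.2.1 (a), (b) p. 118; §14.5 L. 14.5.2 (b) pp. 238–239] S1′-fin-TF-COVOL — THE «O1-DEDUP CERTIFICATE» POINTWISE IN THE FRAME:
# at ONE frame `(hK, hanis, Sbad, Δ, mH, mG, m′, m, mHi, t′, t, tH, hherm, hCTM, hACS)`, «O1 ⟸ O4♮ ∧ ARCH-κ-SIGN» (pointwise twin of ★ `TamagawaSingularKappaSystemCertificate`)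

Topic `NumberTheory/Rogawski1990`; namespace `Literature.NumberTheory.Rogawski1990`.  THEOREMS ONLY (one theorem; no definition, no named fact, no instance, no notation, no axiom, no `sorry`).
Cell `pub/hodgecm-mathlib`, crux H413 = `stmt-HodgeConjecture-24833` (supports-only, count-neutral).  RULING (R-23) «X2♮ PINNED» (heir LEAD F0P3a-plan (g19) T18-58 (2)(L); director g37 s1877
CONCUR): API twin POINTWISE IN THE FRAME, pen registrar A-plan1 (g35); NEW sibling file — the ★ file of record `TamagawaSingularKappaSystemCertificate` is NOT edited (★-lane rule); ★'s `section Frame`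
binders VERBATIM.  HONEST LABEL: this file proves NO printed statement; HC_CM is proved only modulo the 7 printed citations (2 remaining named inputs: hLiu418 = stmt-HodgeConjecture-24832,
h413 = stmt-HodgeConjecture-24833) until rung 0 closes.

WHY.  The ★ certificate consumes its print organs as WHOLE ∀-sentences `∀ ⟨frame⟩, …`, but its proof is POINTWISE IN THE FRAME: it introduces its own frame binders `hK … hACS` and applies
every hypothesis AT THOSE SAME BINDERS only.  Hence the same proof text proves the pointwise statement below, from which the whole-sentence certificate is a one-liner
(`fun h₁ h₂ hK … hACS => …_pointwise … hK … hACS (h₁ hK … hACS) (h₂ hK … hACS)`) and so is the PINNED composition of the LH5 leaf `Cruxes/H413/Lines/F0_P3c_S1finTFCovolPaydown.lean`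
at the frame `Tinf := archCanonicalTransferFactor L H′ μω`, `Δ := finExplicitCollection …` (T18-58 (F2): no un-pinned instance of a print organ is needed on the road to the row of record).

WHAT.
* `finPartners_kappaSystem_of_reference_of_archSign_pointwise` — frame binders `(hK) … (hACS)` explicit (= ★'s conclusion frame block :420–451; the four letters this proof does not
  read are kept POSITIONALLY as `_hK` `_hherm` `_hCTM` `_hACS`, 0-warning profile), then `(href : O4♮ AT THAT FRAME)`
  (★ :259–330 VERBATIM), `(hAKS : ARCH-κ-SIGN AT THAT FRAME, for every (Q-fin)+(COH-fin)+(LEV) system)` (★ :363–418 VERBATIM), conclusion O1 at that frame (★ :452–512 VERBATIM);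
  proof = ★ :514–628 VERBATIM with the ★ frame-`intro` :513 dropped and two token edits: `href hK … hACS` ↦ `href` (★ :514) and `hAKS hK … hACS mGs₀ …` ↦ `hAKS mGs₀ …` (★ :613) —
  the ONLY two hypothesis applications of the ★ proof, both at the proof's OWN frame binders.

## References
* [Rogawski1990] J. D. Rogawski, *Automorphic Representations of Unitary Groups in Three Variables*, Ann. of Math. Stud. 123 (1990): §1.7 p. 6, p. 11; §4.3 (4.3.1) pp. 43–44;
  §8.1 Props. 8.1.3, 8.1.4 pp. 116–118; §8.2 Prop. 8.2.1 (a), (b) p. 118; §14.5 Lemma 14.5.2 (b) pp. 238–239; Prop. 10.1.2 (b) p. 153.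
* [Kottwitz1988] R. E. Kottwitz, *Tamagawa numbers*, Ann. of Math. 127 (1988), §1, Thm. 1, Prop. 2.
* [DeitmarEchterhoff2014] A. Deitmar, S. Echterhoff, *Principles of Harmonic Analysis*, 2nd ed. (2014), Thm. 1.5.3.
-/

set_option autoImplicit false

noncomputable section

open MeasureTheory Measure NumberField IsDedekindDomain
open Literature.MeasureTheory.Group Literature.MeasureTheory.RestrictedProduct
open Literature.Topology.RestrictedProduct Literature.Topology.Algebra.RestrictedProduct
open scoped Matrix MatrixGroups RestrictedProduct NNReal ENNReal Topology

namespace Literature.NumberTheory.Rogawski1990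

open Literature.NumberTheory.Automorphic
open Literature.AlgebraicGeometry.ShimuraVarieties (unitaryGroup hermForm)

section Frame

variable (L : Type) [Field L] [NumberField L] [IsCMField L]

variable (H' : Matrix (Fin 3) (Fin 3) L) (Tinf : ArchTransferFactor L H')
    -- σ-algebras of the `G′` side (★ (O10-c5) block), of `H_v`, `G_∞`, `H_∞`, and the Haar data — EXACTLY ★ `SingularEllipticTransfer`'s binders
    [∀ g : (UnitaryGroup.cmDatum L 3 H').Adelic, MeasurableSpace ((UnitaryGroup.cmDatum L 3 H').Adelic ⧸ Subgroup.centralizer ({g} : Set (UnitaryGroup.cmDatum L 3 H').Adelic))]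
    [∀ g : (UnitaryGroup.cmDatum L 3 H').Adelic, BorelSpace ((UnitaryGroup.cmDatum L 3 H').Adelic ⧸ Subgroup.centralizer ({g} : Set (UnitaryGroup.cmDatum L 3 H').Adelic))]
    [∀ γ : UnitaryGroup.arch (↥(maximalRealSubfield L)) L (IsCMField.complexConj L) 3 H',
      MeasurableSpace (UnitaryGroup.arch (↥(maximalRealSubfield L)) L (IsCMField.complexConj L) 3 H' ⧸ Subgroup.centralizer ({γ} : Set (UnitaryGroup.arch (↥(maximalRealSubfield L)) L (IsCMField.complexConj L) 3 H')))]
    [∀ γ : UnitaryGroup.arch (↥(maximalRealSubfield L)) L (IsCMField.complexConj L) 3 H',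
      BorelSpace (UnitaryGroup.arch (↥(maximalRealSubfield L)) L (IsCMField.complexConj L) 3 H' ⧸ Subgroup.centralizer ({γ} : Set (UnitaryGroup.arch (↥(maximalRealSubfield L)) L (IsCMField.complexConj L) 3 H')))]
    [∀ (v : HeightOneSpectrum (𝓞 ↥(maximalRealSubfield L))) (γ : (UnitaryGroup.cmDatum L 3 H').Local v),
      MeasurableSpace ((UnitaryGroup.cmDatum L 3 H').Local v ⧸ Subgroup.centralizer ({γ} : Set ((UnitaryGroup.cmDatum L 3 H').Local v)))]
    [∀ (v : HeightOneSpectrum (𝓞 ↥(maximalRealSubfield L))) (γ : (UnitaryGroup.cmDatum L 3 H').Local v),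
      BorelSpace ((UnitaryGroup.cmDatum L 3 H').Local v ⧸ Subgroup.centralizer ({γ} : Set ((UnitaryGroup.cmDatum L 3 H').Local v)))]
    [∀ v : HeightOneSpectrum (𝓞 ↥(maximalRealSubfield L)), MeasurableSpace ((UnitaryGroup.cmDatum L 3 H').Local v)] [∀ v : HeightOneSpectrum (𝓞 ↥(maximalRealSubfield L)), BorelSpace ((UnitaryGroup.cmDatum L 3 H').Local v)]
    [MeasurableSpace (UnitaryGroup.cmDatum L 3 H').Adelic] [BorelSpace (UnitaryGroup.cmDatum L 3 H').Adelic]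
    [MeasurableSpace (UnitaryGroup.arch (↥(maximalRealSubfield L)) L (IsCMField.complexConj L) 3 H')] [BorelSpace (UnitaryGroup.arch (↥(maximalRealSubfield L)) L (IsCMField.complexConj L) 3 H')]
    [∀ γ : (UnitaryGroup.cmDatum L 3 H').Adelic, MeasurableSpace (↥(Subgroup.centralizer ({γ} : Set (UnitaryGroup.cmDatum L 3 H').Adelic)) ⧸
      ((UnitaryGroup.cmDatum L 3 H').quotientSubgroup ⊓ Subgroup.centralizer ({γ} : Set (UnitaryGroup.cmDatum L 3 H').Adelic)).subgroupOf (Subgroup.centralizer ({γ} : Set (UnitaryGroup.cmDatum L 3 H').Adelic)))]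
    [∀ γ : (UnitaryGroup.cmDatum L 3 H').Adelic, BorelSpace (↥(Subgroup.centralizer ({γ} : Set (UnitaryGroup.cmDatum L 3 H').Adelic)) ⧸
      ((UnitaryGroup.cmDatum L 3 H').quotientSubgroup ⊓ Subgroup.centralizer ({γ} : Set (UnitaryGroup.cmDatum L 3 H').Adelic)).subgroupOf (Subgroup.centralizer ({γ} : Set (UnitaryGroup.cmDatum L 3 H').Adelic)))]
    [hCcl : ∀ γ : (UnitaryGroup.cmDatum L 3 H').Adelic, IsClosed ((Subgroup.centralizer ({γ} : Set (UnitaryGroup.cmDatum L 3 H').Adelic) : Subgroup (UnitaryGroup.cmDatum L 3 H').Adelic) : Set (UnitaryGroup.cmDatum L 3 H').Adelic)]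
    [∀ γ : (UnitaryGroup.cmDatum L 3 H').Adelic, (count : Measure ↥(((UnitaryGroup.cmDatum L 3 H').quotientSubgroup ⊓ Subgroup.centralizer ({γ} : Set (UnitaryGroup.cmDatum L 3 H').Adelic)).subgroupOf
      (Subgroup.centralizer ({γ} : Set (UnitaryGroup.cmDatum L 3 H').Adelic)))).IsHaarMeasure]
    [∀ v : HeightOneSpectrum (𝓞 ↥(maximalRealSubfield L)), MeasurableSpace ((UnitaryGroup.cmDatum L 2 (Matrix.of fun i j : Fin 2 => if i.val + j.val + 1 = 2 then (1 : L) else 0)).Local v ×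
        (UnitaryGroup.cmDatum L 1 (Matrix.of fun i j : Fin 1 => if i.val + j.val + 1 = 1 then (1 : L) else 0)).Local v)]
    [∀ v : HeightOneSpectrum (𝓞 ↥(maximalRealSubfield L)), BorelSpace ((UnitaryGroup.cmDatum L 2 (Matrix.of fun i j : Fin 2 => if i.val + j.val + 1 = 2 then (1 : L) else 0)).Local v ×
        (UnitaryGroup.cmDatum L 1 (Matrix.of fun i j : Fin 1 => if i.val + j.val + 1 = 1 then (1 : L) else 0)).Local v)]
    [∀ (v : HeightOneSpectrum (𝓞 ↥(maximalRealSubfield L))) (a : ((UnitaryGroup.cmDatum L 2 (Matrix.of fun i j : Fin 2 => if i.val + j.val + 1 = 2 then (1 : L) else 0)).Local v ×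
        (UnitaryGroup.cmDatum L 1 (Matrix.of fun i j : Fin 1 => if i.val + j.val + 1 = 1 then (1 : L) else 0)).Local v)),
      MeasurableSpace (((UnitaryGroup.cmDatum L 2 (Matrix.of fun i j : Fin 2 => if i.val + j.val + 1 = 2 then (1 : L) else 0)).Local v ×
        (UnitaryGroup.cmDatum L 1 (Matrix.of fun i j : Fin 1 => if i.val + j.val + 1 = 1 then (1 : L) else 0)).Local v) ⧸ Subgroup.centralizer ({a} : Set ((UnitaryGroup.cmDatum L 2 (Matrix.of fun i j : Fin 2 => if i.val + j.val + 1 = 2 then (1 : L) else 0)).Local v ×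
        (UnitaryGroup.cmDatum L 1 (Matrix.of fun i j : Fin 1 => if i.val + j.val + 1 = 1 then (1 : L) else 0)).Local v)))]
    [∀ (v : HeightOneSpectrum (𝓞 ↥(maximalRealSubfield L))) (a : ((UnitaryGroup.cmDatum L 2 (Matrix.of fun i j : Fin 2 => if i.val + j.val + 1 = 2 then (1 : L) else 0)).Local v ×
        (UnitaryGroup.cmDatum L 1 (Matrix.of fun i j : Fin 1 => if i.val + j.val + 1 = 1 then (1 : L) else 0)).Local v)),
      BorelSpace (((UnitaryGroup.cmDatum L 2 (Matrix.of fun i j : Fin 2 => if i.val + j.val + 1 = 2 then (1 : L) else 0)).Local v ×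
        (UnitaryGroup.cmDatum L 1 (Matrix.of fun i j : Fin 1 => if i.val + j.val + 1 = 1 then (1 : L) else 0)).Local v) ⧸ Subgroup.centralizer ({a} : Set ((UnitaryGroup.cmDatum L 2 (Matrix.of fun i j : Fin 2 => if i.val + j.val + 1 = 2 then (1 : L) else 0)).Local v ×
        (UnitaryGroup.cmDatum L 1 (Matrix.of fun i j : Fin 1 => if i.val + j.val + 1 = 1 then (1 : L) else 0)).Local v)))]
    [MeasurableSpace (UnitaryGroup.arch (↥(maximalRealSubfield L)) L (IsCMField.complexConj L) 3 (Matrix.of fun i j : Fin 3 => if i.val + j.val + 1 = 3 then (1 : L) else 0))] [BorelSpace (UnitaryGroup.arch (↥(maximalRealSubfield L)) L (IsCMField.complexConj L) 3 (Matrix.of fun i j : Fin 3 => if i.val + j.val + 1 = 3 then (1 : L) else 0))]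
    [∀ γ : UnitaryGroup.arch (↥(maximalRealSubfield L)) L (IsCMField.complexConj L) 3 (Matrix.of fun i j : Fin 3 => if i.val + j.val + 1 = 3 then (1 : L) else 0),
      MeasurableSpace (UnitaryGroup.arch (↥(maximalRealSubfield L)) L (IsCMField.complexConj L) 3 (Matrix.of fun i j : Fin 3 => if i.val + j.val + 1 = 3 then (1 : L) else 0) ⧸ Subgroup.centralizer ({γ} : Set (UnitaryGroup.arch (↥(maximalRealSubfield L)) L (IsCMField.complexConj L) 3 (Matrix.of fun i j : Fin 3 => if i.val + j.val + 1 = 3 then (1 : L) else 0))))]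
    [∀ γ : UnitaryGroup.arch (↥(maximalRealSubfield L)) L (IsCMField.complexConj L) 3 (Matrix.of fun i j : Fin 3 => if i.val + j.val + 1 = 3 then (1 : L) else 0),
      BorelSpace (UnitaryGroup.arch (↥(maximalRealSubfield L)) L (IsCMField.complexConj L) 3 (Matrix.of fun i j : Fin 3 => if i.val + j.val + 1 = 3 then (1 : L) else 0) ⧸ Subgroup.centralizer ({γ} : Set (UnitaryGroup.arch (↥(maximalRealSubfield L)) L (IsCMField.complexConj L) 3 (Matrix.of fun i j : Fin 3 => if i.val + j.val + 1 = 3 then (1 : L) else 0))))]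
    [MeasurableSpace (UnitaryGroup.arch (↥(maximalRealSubfield L)) L (IsCMField.complexConj L) 2 (Matrix.of fun i j : Fin 2 => if i.val + j.val + 1 = 2 then (1 : L) else 0) ×
          UnitaryGroup.arch (↥(maximalRealSubfield L)) L (IsCMField.complexConj L) 1 (Matrix.of fun i j : Fin 1 => if i.val + j.val + 1 = 1 then (1 : L) else 0))]
    [BorelSpace (UnitaryGroup.arch (↥(maximalRealSubfield L)) L (IsCMField.complexConj L) 2 (Matrix.of fun i j : Fin 2 => if i.val + j.val + 1 = 2 then (1 : L) else 0) ×
          UnitaryGroup.arch (↥(maximalRealSubfield L)) L (IsCMField.complexConj L) 1 (Matrix.of fun i j : Fin 1 => if i.val + j.val + 1 = 1 then (1 : L) else 0))]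
    [∀ a : (UnitaryGroup.arch (↥(maximalRealSubfield L)) L (IsCMField.complexConj L) 2 (Matrix.of fun i j : Fin 2 => if i.val + j.val + 1 = 2 then (1 : L) else 0) ×
          UnitaryGroup.arch (↥(maximalRealSubfield L)) L (IsCMField.complexConj L) 1 (Matrix.of fun i j : Fin 1 => if i.val + j.val + 1 = 1 then (1 : L) else 0)),
      MeasurableSpace ((UnitaryGroup.arch (↥(maximalRealSubfield L)) L (IsCMField.complexConj L) 2 (Matrix.of fun i j : Fin 2 => if i.val + j.val + 1 = 2 then (1 : L) else 0) ×
          UnitaryGroup.arch (↥(maximalRealSubfield L)) L (IsCMField.complexConj L) 1 (Matrix.of fun i j : Fin 1 => if i.val + j.val + 1 = 1 then (1 : L) else 0)) ⧸ Subgroup.centralizer ({a} : Set (UnitaryGroup.arch (↥(maximalRealSubfield L)) L (IsCMField.complexConj L) 2 (Matrix.of fun i j : Fin 2 => if i.val + j.val + 1 = 2 then (1 : L) else 0) ×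
          UnitaryGroup.arch (↥(maximalRealSubfield L)) L (IsCMField.complexConj L) 1 (Matrix.of fun i j : Fin 1 => if i.val + j.val + 1 = 1 then (1 : L) else 0))))]
    [∀ a : (UnitaryGroup.arch (↥(maximalRealSubfield L)) L (IsCMField.complexConj L) 2 (Matrix.of fun i j : Fin 2 => if i.val + j.val + 1 = 2 then (1 : L) else 0) ×
          UnitaryGroup.arch (↥(maximalRealSubfield L)) L (IsCMField.complexConj L) 1 (Matrix.of fun i j : Fin 1 => if i.val + j.val + 1 = 1 then (1 : L) else 0)),
      BorelSpace ((UnitaryGroup.arch (↥(maximalRealSubfield L)) L (IsCMField.complexConj L) 2 (Matrix.of fun i j : Fin 2 => if i.val + j.val + 1 = 2 then (1 : L) else 0) ×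
          UnitaryGroup.arch (↥(maximalRealSubfield L)) L (IsCMField.complexConj L) 1 (Matrix.of fun i j : Fin 1 => if i.val + j.val + 1 = 1 then (1 : L) else 0)) ⧸ Subgroup.centralizer ({a} : Set (UnitaryGroup.arch (↥(maximalRealSubfield L)) L (IsCMField.complexConj L) 2 (Matrix.of fun i j : Fin 2 => if i.val + j.val + 1 = 2 then (1 : L) else 0) ×
          UnitaryGroup.arch (↥(maximalRealSubfield L)) L (IsCMField.complexConj L) 1 (Matrix.of fun i j : Fin 1 => if i.val + j.val + 1 = 1 then (1 : L) else 0))))]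
    (νH : ∀ v : HeightOneSpectrum (𝓞 ↥(maximalRealSubfield L)), Measure ((UnitaryGroup.cmDatum L 2 (Matrix.of fun i j : Fin 2 => if i.val + j.val + 1 = 2 then (1 : L) else 0)).Local v ×
        (UnitaryGroup.cmDatum L 1 (Matrix.of fun i j : Fin 1 => if i.val + j.val + 1 = 1 then (1 : L) else 0)).Local v))
    (νG : ∀ v : HeightOneSpectrum (𝓞 ↥(maximalRealSubfield L)), Measure ((UnitaryGroup.cmDatum L 3 H').Local v))
    [∀ v, IsFiniteMeasureOnCompacts (νH v)] [∀ v, (νH v).IsMulRightInvariant]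
    [∀ v, (νG v).IsHaarMeasure] [∀ v, (νG v).IsMulRightInvariant]  -- MAIN-b's strength (F2): `νG_v` Haar
    (νGi : Measure (UnitaryGroup.arch (↥(maximalRealSubfield L)) L (IsCMField.complexConj L) 3 H')) (νqi : Measure (UnitaryGroup.arch (↥(maximalRealSubfield L)) L (IsCMField.complexConj L) 3 (Matrix.of fun i j : Fin 3 => if i.val + j.val + 1 = 3 then (1 : L) else 0)))
    (νHi : Measure (UnitaryGroup.arch (↥(maximalRealSubfield L)) L (IsCMField.complexConj L) 2 (Matrix.of fun i j : Fin 2 => if i.val + j.val + 1 = 2 then (1 : L) else 0) ×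
          UnitaryGroup.arch (↥(maximalRealSubfield L)) L (IsCMField.complexConj L) 1 (Matrix.of fun i j : Fin 1 => if i.val + j.val + 1 = 1 then (1 : L) else 0)))
    [IsFiniteMeasureOnCompacts νGi] [νGi.IsMulRightInvariant] [IsFiniteMeasureOnCompacts νqi] [νqi.IsMulRightInvariant]
    [IsFiniteMeasureOnCompacts νHi] [νHi.IsMulRightInvariant]

/-! ## §2 THE CERTIFICATE «O1 ⟸ O4♮ ∧ ARCH-κ-SIGN∀» (organ texts VERBATIM) -/

omit [∀ g : (UnitaryGroup.cmDatum L 3 H').Adelic, MeasurableSpace ((UnitaryGroup.cmDatum L 3 H').Adelic ⧸ Subgroup.centralizer ({g} : Set (UnitaryGroup.cmDatum L 3 H').Adelic))]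
  [∀ g : (UnitaryGroup.cmDatum L 3 H').Adelic, BorelSpace ((UnitaryGroup.cmDatum L 3 H').Adelic ⧸ Subgroup.centralizer ({g} : Set (UnitaryGroup.cmDatum L 3 H').Adelic))] in
set_option maxHeartbeats 16000000 in
set_option synthInstance.maxHeartbeats 800000 in
/-- **THE «O1-DEDUP CERTIFICATE», POINTWISE IN THE FRAME**: at one frame `(hK … hACS)`, O4♮ «T′-κ-SYSTEM» at that frame (`href`) and ARCH-κ-SIGN at that frame for every
(Q-fin)+(COH-fin)+(LEV) system (`hAKS`) imply O1 «κ-SYSTEM» at the SAME frame — the pointwise twin of ★ `finPartners_kappaSystem_of_reference_of_archSign` (same proof text: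
CENTRAL REPAIR of print's partners, κ-block transport class by class). [cite: Rogawski1990, §8.2 Prop. 8.2.1 (a), (b) p. 118; §14.5 Lemma 14.5.2 (b) pp. 238–239; §1.7 p. 6, p. 11; §4.3 pp. 43–44]
[cite: Kottwitz1988, Thm. 1, Prop. 2] [cite: DeitmarEchterhoff2014, Thm. 1.5.3] -/
theorem finPartners_kappaSystem_of_reference_of_archSign_pointwise
    (_hK : ∀ v : HeightOneSpectrum (𝓞 ↥(maximalRealSubfield L)), νG v (UnitaryGroup.cmLocalIntegralLevel L 3 H' v : Set ((UnitaryGroup.cmDatum L 3 H').Local v)) = 1)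
  (hanis : ∀ x : Fin 3 → L, hermForm (cmConjRingHom L) H' x x = 0 → x = 0)
  (Sbad : Finset (HeightOneSpectrum (𝓞 ↥(maximalRealSubfield L))))
      (Δ : ∀ v : HeightOneSpectrum (𝓞 ↥(maximalRealSubfield L)), LocalTransferFactor L H' v)
      (mH : ∀ v : HeightOneSpectrum (𝓞 ↥(maximalRealSubfield L)),
        OrbitalMeasureFamily ((UnitaryGroup.cmDatum L 2 (Matrix.of fun i j : Fin 2 => if i.val + j.val + 1 = 2 then (1 : L) else 0)).Local v ×
          (UnitaryGroup.cmDatum L 1 (Matrix.of fun i j : Fin 1 => if i.val + j.val + 1 = 1 then (1 : L) else 0)).Local v))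
      (mG : ∀ v : HeightOneSpectrum (𝓞 ↥(maximalRealSubfield L)), OrbitalMeasureFamily ((UnitaryGroup.cmDatum L 3 H').Local v))
  (m' : OrbitalMeasureFamily (UnitaryGroup.arch (↥(maximalRealSubfield L)) L (IsCMField.complexConj L) 3 H'))
        (m : OrbitalMeasureFamily (UnitaryGroup.arch (↥(maximalRealSubfield L)) L (IsCMField.complexConj L) 3
          (Matrix.of fun i j : Fin 3 => if i.val + j.val + 1 = 3 then (1 : L) else 0)))
        (mHi : OrbitalMeasureFamily (UnitaryGroup.arch (↥(maximalRealSubfield L)) L (IsCMField.complexConj L) 2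
            (Matrix.of fun i j : Fin 2 => if i.val + j.val + 1 = 2 then (1 : L) else 0) ×
          UnitaryGroup.arch (↥(maximalRealSubfield L)) L (IsCMField.complexConj L) 1
            (Matrix.of fun i j : Fin 1 => if i.val + j.val + 1 = 1 then (1 : L) else 0)))
        (t' : ∀ γ' : UnitaryGroup.arch (↥(maximalRealSubfield L)) L (IsCMField.complexConj L) 3 H',
          Measure (Subgroup.centralizer ({γ'} : Set (UnitaryGroup.arch (↥(maximalRealSubfield L)) L (IsCMField.complexConj L) 3 H'))))
        (t : ∀ γ : UnitaryGroup.arch (↥(maximalRealSubfield L)) L (IsCMField.complexConj L) 3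
            (Matrix.of fun i j : Fin 3 => if i.val + j.val + 1 = 3 then (1 : L) else 0),
          Measure (Subgroup.centralizer ({γ} : Set (UnitaryGroup.arch (↥(maximalRealSubfield L)) L (IsCMField.complexConj L) 3
            (Matrix.of fun i j : Fin 3 => if i.val + j.val + 1 = 3 then (1 : L) else 0)))))
        (tH : ∀ γH : UnitaryGroup.arch (↥(maximalRealSubfield L)) L (IsCMField.complexConj L) 2
              (Matrix.of fun i j : Fin 2 => if i.val + j.val + 1 = 2 then (1 : L) else 0) ×
            UnitaryGroup.arch (↥(maximalRealSubfield L)) L (IsCMField.complexConj L) 1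
              (Matrix.of fun i j : Fin 1 => if i.val + j.val + 1 = 1 then (1 : L) else 0),
          Measure (Subgroup.centralizer ({γH} : Set (UnitaryGroup.arch (↥(maximalRealSubfield L)) L (IsCMField.complexConj L) 2
              (Matrix.of fun i j : Fin 2 => if i.val + j.val + 1 = 2 then (1 : L) else 0) ×
            UnitaryGroup.arch (↥(maximalRealSubfield L)) L (IsCMField.complexConj L) 1
              (Matrix.of fun i j : Fin 1 => if i.val + j.val + 1 = 1 then (1 : L) else 0)))))
    (_hherm : (H'.map (cmConjRingHom L)).transpose = H')
    (_hCTM : CanonicalTransferMatrix L H' Tinf.Δ νH νG Sbad Δ mH mG)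
    (_hACS : ArchCanonicalSingularMatrix L H' Tinf νGi νqi νHi hanis m' m mHi t' t tH)
    (href :
        ∃ (mGs₀ : ∀ v : HeightOneSpectrum (𝓞 ↥(maximalRealSubfield L)), OrbitalMeasureFamily ((UnitaryGroup.cmDatum L 3 H').Local v))
          (tGs₀ : ∀ (v : HeightOneSpectrum (𝓞 ↥(maximalRealSubfield L))) (γ : (UnitaryGroup.cmDatum L 3 H').Local v), Measure ↥(Subgroup.centralizer ({γ} : Set ((UnitaryGroup.cmDatum L 3 H').Local v)))),
          (∀ v, (mGs₀ v).IsQuotientOf (fun x : (UnitaryGroup.cmDatum L 3 H').Local v => ∃ γ₀ : (UnitaryGroup.cmDatum L 3 H').Rational, ¬ IsRegularElt (γ₀.val : GL (Fin 3) L) ∧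
                Corresponds (UnitaryGroup.conjLocal L (IsCMField.complexConj L) v)
                  ((UnitaryGroup.adelicForm L 3 H').map (UnitaryGroup.adeleToLocal L v))
                  ((UnitaryGroup.adelicForm L 3 H').map (UnitaryGroup.adeleToLocal L v))
                  ((UnitaryGroup.cmDatum L 3 H').toLocal v ((UnitaryGroup.cmDatum L 3 H').toAdelic γ₀)) x) (νG v) (tGs₀ v)) ∧
          (∀ (v : HeightOneSpectrum (𝓞 ↥(maximalRealSubfield L))) (γ₁ γ₂ q : (UnitaryGroup.cmDatum L 3 H').Local v) (hq : (MulAut.conj q : (UnitaryGroup.cmDatum L 3 H').Local v ≃* (UnitaryGroup.cmDatum L 3 H').Local v) γ₁ = γ₂),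
            (∃ γ₀ : (UnitaryGroup.cmDatum L 3 H').Rational, ¬ IsRegularElt (γ₀.val : GL (Fin 3) L) ∧
                Corresponds (UnitaryGroup.conjLocal L (IsCMField.complexConj L) v)
                  ((UnitaryGroup.adelicForm L 3 H').map (UnitaryGroup.adeleToLocal L v))
                  ((UnitaryGroup.adelicForm L 3 H').map (UnitaryGroup.adeleToLocal L v))
                  ((UnitaryGroup.cmDatum L 3 H').toLocal v ((UnitaryGroup.cmDatum L 3 H').toAdelic γ₀)) γ₁) →
            Measure.map (subgroupCongrHomeomorph (MulAut.conj q : (UnitaryGroup.cmDatum L 3 H').Local v ≃* (UnitaryGroup.cmDatum L 3 H').Local v) (Subgroup.centralizer ({γ₁} : Set ((UnitaryGroup.cmDatum L 3 H').Local v)))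
              (Subgroup.centralizer ({γ₂} : Set ((UnitaryGroup.cmDatum L 3 H').Local v))) (forall_apply_mem_centralizer_singleton_iff_of_eq (MulAut.conj q : (UnitaryGroup.cmDatum L 3 H').Local v ≃* (UnitaryGroup.cmDatum L 3 H').Local v) hq)
              (continuous_mulAutConj q) (continuous_mulAutConj_symm q)) (tGs₀ v γ₁) = tGs₀ v γ₂) ∧
          (∀ γ₀ : (UnitaryGroup.cmDatum L 3 H').Rational, ¬ IsRegularElt (γ₀.val : GL (Fin 3) L) →
            ∀ᶠ v : HeightOneSpectrum (𝓞 ↥(maximalRealSubfield L)) in Filter.cofinite,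
              tGs₀ v ((UnitaryGroup.cmDatum L 3 H').toLocal v ((UnitaryGroup.cmDatum L 3 H').toAdelic γ₀))
                (Subtype.val ⁻¹' (UnitaryGroup.cmLocalIntegralLevel L 3 H' v : Set ((UnitaryGroup.cmDatum L 3 H').Local v))) = 1) ∧
          (∀ (γ₀ : (UnitaryGroup.cmDatum L 3 H').Rational) (e₁ e₂ : L), e₁ ≠ e₂ →
            ((((γ₀ : unitaryGroup (cmConjRingHom L) H').val : GL (Fin 3) L) : Matrix (Fin 3) (Fin 3) L) - e₁ • (1 : Matrix (Fin 3) (Fin 3) L)) * ((((γ₀ : unitaryGroup (cmConjRingHom L) H').val : GL (Fin 3) L) : Matrix (Fin 3) (Fin 3) L) - e₂ • (1 : Matrix (Fin 3) (Fin 3) L)) = 0 →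
            (¬ ∃ ζ : L, (((γ₀ : unitaryGroup (cmConjRingHom L) H').val : GL (Fin 3) L) : Matrix (Fin 3) (Fin 3) L) = ζ • (1 : Matrix (Fin 3) (Fin 3) L)) →
            (((γ₀ : unitaryGroup (cmConjRingHom L) H').val : GL (Fin 3) L) : Matrix (Fin 3) (Fin 3) L).charpoly =
              (Polynomial.X - Polynomial.C e₁) ^ 2 * (Polynomial.X - Polynomial.C e₂) →
            ∀ (γH : (UnitaryGroup.cmDatum L 2 (Matrix.of fun i j : Fin 2 => if i.val + j.val + 1 = 2 then (1 : L) else 0)).Rational ×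
                (UnitaryGroup.cmDatum L 1 (Matrix.of fun i j : Fin 1 => if i.val + j.val + 1 = 1 then (1 : L) else 0)).Rational),
              (((γH.1 : unitaryGroup (cmConjRingHom L) (Matrix.of fun i j : Fin 2 => if i.val + j.val + 1 = 2 then (1 : L) else 0)).val : GL (Fin 2) L) : Matrix (Fin 2) (Fin 2) L) =
                e₁ • (1 : Matrix (Fin 2) (Fin 2) L) →
              (((γH.2 : unitaryGroup (cmConjRingHom L) (Matrix.of fun i j : Fin 1 => if i.val + j.val + 1 = 1 then (1 : L) else 0)).val : GL (Fin 1) L) : Matrix (Fin 1) (Fin 1) L) 0 0 = e₂ →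
              ∃ (c : HeightOneSpectrum (𝓞 ↥(maximalRealSubfield L)) → ℂ), (∀ v, c v ≠ 0) ∧
                (∀ (v : HeightOneSpectrum (𝓞 ↥(maximalRealSubfield L)))
                      (fH : (UnitaryGroup.cmDatum L 2 (Matrix.of fun i j : Fin 2 => if i.val + j.val + 1 = 2 then (1 : L) else 0)).Local v × (UnitaryGroup.cmDatum L 1 (Matrix.of fun i j : Fin 1 => if i.val + j.val + 1 = 1 then (1 : L) else 0)).Local v → ℂ) (f : (UnitaryGroup.cmDatum L 3 H').Local v → ℂ),
                    IsLocSmooth f → IsLocSmooth fH → IsLocalDeltaTransfer L H' v (Δ v) (mH v) (mG v) fH f →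
                    localStableOrbitalIntegral L 3 H' v (mGs₀ v) f ((UnitaryGroup.cmDatum L 3 H').toLocal v ((UnitaryGroup.cmDatum L 3 H').toAdelic γ₀)) =
                      c v * fH ((UnitaryGroup.cmDatum L 2 (Matrix.of fun i j : Fin 2 => if i.val + j.val + 1 = 2 then (1 : L) else 0)).toLocal v ((UnitaryGroup.cmDatum L 2 (Matrix.of fun i j : Fin 2 => if i.val + j.val + 1 = 2 then (1 : L) else 0)).toAdelic γH.1),
                        (UnitaryGroup.cmDatum L 1 (Matrix.of fun i j : Fin 1 => if i.val + j.val + 1 = 1 then (1 : L) else 0)).toLocal v ((UnitaryGroup.cmDatum L 1 (Matrix.of fun i j : Fin 1 => if i.val + j.val + 1 = 1 then (1 : L) else 0)).toAdelic γH.2)))) ∧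
          (∀ [∀ v : HeightOneSpectrum (𝓞 ↥(maximalRealSubfield L)), MeasurableSpace ↥(UnitaryGroup.localPi L (IsCMField.complexConj L) 3 H' v)]
              [∀ v : HeightOneSpectrum (𝓞 ↥(maximalRealSubfield L)), BorelSpace ↥(UnitaryGroup.localPi L (IsCMField.complexConj L) 3 H' v)]
              [MeasurableSpace ↥(UnitaryGroup.finAdelic (↥(maximalRealSubfield L)) L (IsCMField.complexConj L) 3 H')] [BorelSpace ↥(UnitaryGroup.finAdelic (↥(maximalRealSubfield L)) L (IsCMField.complexConj L) 3 H')]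
              (ψ : ∀ v : HeightOneSpectrum (𝓞 ↥(maximalRealSubfield L)), ↥(UnitaryGroup.localPi L (IsCMField.complexConj L) 3 H' v) ≃ₜ* (UnitaryGroup.cmDatum L 3 H').Local v)
              (hψ : ψ = fun v => UnitaryGroup.localPiEquiv L (IsCMField.complexConj L) 3 H' v)
              (e : ↥(UnitaryGroup.arch (↥(maximalRealSubfield L)) L (IsCMField.complexConj L) 3 H') × ↥(UnitaryGroup.finAdelic (↥(maximalRealSubfield L)) L (IsCMField.complexConj L) 3 H') ≃* (UnitaryGroup.cmDatum L 3 H').Adelic)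
              (_ : e = (UnitaryGroup.adelicProdEquiv (↥(maximalRealSubfield L)) L (IsCMField.complexConj L) 3 H').symm.toMulEquiv) (he : Continuous e) (hes : Continuous e.symm)
              (hg : ∀ g : (UnitaryGroup.cmDatum L 3 H').Adelic, e (UnitaryGroup.archPart (↥(maximalRealSubfield L)) L (IsCMField.complexConj L) 3 H' g, UnitaryGroup.finPart (↥(maximalRealSubfield L)) L (IsCMField.complexConj L) 3 H' g) = g)
              (tA : ∀ c : ConjClasses (UnitaryGroup.cmDatum L 3 H').Rational, Measure (Subgroup.centralizer ({((UnitaryGroup.cmDatum L 3 H').toAdelic (Quotient.out c))} : Set (UnitaryGroup.cmDatum L 3 H').Adelic)))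
              (_ : ∀ c, IsHaarMeasure (tA c)) (_ : ∀ c, (tA c).IsMulRightInvariant) (_ : ∀ c, (tA c).IsInvInvariant),
            (∀ c : ConjClasses (UnitaryGroup.cmDatum L 3 H').Rational, ¬ IsRegularElt ((Quotient.out c).val : GL (Fin 3) L) →
              (¬ ∃ ζ : L, (((Quotient.out c).val : GL (Fin 3) L) : Matrix (Fin 3) (Fin 3) L) = ζ • (1 : Matrix (Fin 3) (Fin 3) L)) →
              ∃ S₀ : Finset (HeightOneSpectrum (𝓞 ↥(maximalRealSubfield L))), UnitaryGroup.IsNormalisedOff L 3 H' mGs₀ ((UnitaryGroup.cmDatum L 3 H').toAdelic (Quotient.out c)) S₀ ∧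
              ∃ (ρ : Measure (cutout (fun v => UnitaryGroup.localInt L (IsCMField.complexConj L) 3 H' v) (fun v => (Subgroup.centralizer ({(UnitaryGroup.finAdelicEquiv (↥(maximalRealSubfield L)) L (IsCMField.complexConj L) 3 H') (UnitaryGroup.finPart (↥(maximalRealSubfield L)) L (IsCMField.complexConj L) 3 H' ((UnitaryGroup.cmDatum L 3 H').toAdelic (Quotient.out c))) v} : Set ↥(UnitaryGroup.localPi L (IsCMField.complexConj L) 3 H' v)))))) (ρM : Measure (Subgroup.centralizer ({(UnitaryGroup.finAdelicEquiv (↥(maximalRealSubfield L)) L (IsCMField.complexConj L) 3 H') (UnitaryGroup.finPart (↥(maximalRealSubfield L)) L (IsCMField.complexConj L) 3 H' ((UnitaryGroup.cmDatum L 3 H').toAdelic (Quotient.out c)))} : Set (Πʳ v : HeightOneSpectrum (𝓞 ↥(maximalRealSubfield L)), [↥(UnitaryGroup.localPi L (IsCMField.complexConj L) 3 H' v), UnitaryGroup.localInt L (IsCMField.complexConj L) 3 H' v])))) (tf : Measure (Subgroup.centralizer ({(UnitaryGroup.finPart (↥(maximalRealSubfield L)) L (IsCMField.complexConj L) 3 H'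 ((UnitaryGroup.cmDatum L 3 H').toAdelic (Quotient.out c)))} : Set (UnitaryGroup.finAdelic (↥(maximalRealSubfield L)) L (IsCMField.complexConj L) 3 H'))))
                (tP : Measure ((Subgroup.centralizer ({UnitaryGroup.archPart (↥(maximalRealSubfield L)) L (IsCMField.complexConj L) 3 H' ((UnitaryGroup.cmDatum L 3 H').toAdelic (Quotient.out c))} : Set (UnitaryGroup.arch (↥(maximalRealSubfield L)) L (IsCMField.complexConj L) 3 H'))).prod (Subgroup.centralizer ({(UnitaryGroup.finPart (↥(maximalRealSubfield L)) L (IsCMField.complexConj L) 3 H' ((UnitaryGroup.cmDatum L 3 H').toAdelic (Quotient.out c)))} : Set (UnitaryGroup.finAdelic (↥(maximalRealSubfield L)) L (IsCMField.complexConj L) 3 H'))))),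
                (∀ v, v ∉ S₀ → (Measure.map (subgroupCongrHomeomorph (ψ v).symm.toMulEquiv (Subgroup.centralizer ({((UnitaryGroup.cmDatum L 3 H').toLocal v ((UnitaryGroup.cmDatum L 3 H').toAdelic (Quotient.out c)))} : Set ((UnitaryGroup.cmDatum L 3 H').Local v))) (Subgroup.centralizer ({(UnitaryGroup.finAdelicEquiv (↥(maximalRealSubfield L)) L (IsCMField.complexConj L) 3 H') (UnitaryGroup.finPart (↥(maximalRealSubfield L)) L (IsCMField.complexConj L) 3 H' ((UnitaryGroup.cmDatum L 3 H').toAdelic (Quotient.out c))) v} : Set ↥(UnitaryGroup.localPi L (IsCMField.complexConj L) 3 H' v))) (UnitaryGroup.localPiEquiv_symm_mem_centralizer_iff L 3 H' v ((UnitaryGroup.cmDatum L 3 H').toAdelic (Quotient.out c)) (ψ v) (congrFun hψ v)) (ψ v).symm.continuous (ψ v).continuous) (tGs₀ v ((UnitaryGroup.cmDatum L 3 H').toLocal v ((UnitaryGroup.cmDatum L 3 H').toAdelic (Quotient.out c))))) ((((inH (fun v => UnitaryGroup.localInt L (IsCMField.complexConj L) 3 H' v) (fun v => (Subgroup.centralizer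 ({(UnitaryGroup.finAdelicEquiv (↥(maximalRealSubfield L)) L (IsCMField.complexConj L) 3 H') (UnitaryGroup.finPart (↥(maximalRealSubfield L)) L (IsCMField.complexConj L) 3 H' ((UnitaryGroup.cmDatum L 3 H').toAdelic (Quotient.out c))) v} : Set ↥(UnitaryGroup.localPi L (IsCMField.complexConj L) 3 H' v)))) v) : Subgroup (Subgroup.centralizer ({(UnitaryGroup.finAdelicEquiv (↥(maximalRealSubfield L)) L (IsCMField.complexConj L) 3 H') (UnitaryGroup.finPart (↥(maximalRealSubfield L)) L (IsCMField.complexConj L) 3 H' ((UnitaryGroup.cmDatum L 3 H').toAdelic (Quotient.out c))) v} : Set ↥(UnitaryGroup.localPi L (IsCMField.complexConj L) 3 H' v)))) : Set (Subgroup.centralizer ({(UnitaryGroup.finAdelicEquiv (↥(maximalRealSubfield L)) L (IsCMField.complexConj L) 3 H') (UnitaryGroup.finPart (↥(maximalRealSubfield L)) L (IsCMField.complexConj L) 3 H' ((UnitaryGroup.cmDatum L 3 H').toAdelic (Quotient.out c))) v} : Set ↥(UnitaryGroup.localPi L (IsCMField.complexConj L) 3 H' v))))) = 1) ∧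
                ρ = Measure.map (cutoutEquiv (fun v => UnitaryGroup.localInt L (IsCMField.complexConj L) 3 H' v) (fun v => (Subgroup.centralizer ({(UnitaryGroup.finAdelicEquiv (↥(maximalRealSubfield L)) L (IsCMField.complexConj L) 3 H') (UnitaryGroup.finPart (↥(maximalRealSubfield L)) L (IsCMField.complexConj L) 3 H' ((UnitaryGroup.cmDatum L 3 H').toAdelic (Quotient.out c))) v} : Set ↥(UnitaryGroup.localPi L (IsCMField.complexConj L) 3 H' v)))))
                (rpMeasure (fun v => (((inH (fun v => UnitaryGroup.localInt L (IsCMField.complexConj L) 3 H' v) (fun v => (Subgroup.centralizer ({(UnitaryGroup.finAdelicEquiv (↥(maximalRealSubfield L)) L (IsCMField.complexConj L) 3 H') (UnitaryGroup.finPart (↥(maximalRealSubfield L)) L (IsCMField.complexConj L) 3 H' ((UnitaryGroup.cmDatum L 3 H').toAdelic (Quotient.out c))) v} : Set ↥(UnitaryGroup.localPi L (IsCMField.complexConj L) 3 H' v)))) v) : Subgroup (Subgroup.centralizer ({(UnitaryGroup.finAdelicEquiv (↥(maximalRealSubfield L)) L (IsCMField.complexConj L) 3 H') (UnitaryGroup.finPart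 (↥(maximalRealSubfield L)) L (IsCMField.complexConj L) 3 H' ((UnitaryGroup.cmDatum L 3 H').toAdelic (Quotient.out c))) v} : Set ↥(UnitaryGroup.localPi L (IsCMField.complexConj L) 3 H' v)))) : Set (Subgroup.centralizer ({(UnitaryGroup.finAdelicEquiv (↥(maximalRealSubfield L)) L (IsCMField.complexConj L) 3 H') (UnitaryGroup.finPart (↥(maximalRealSubfield L)) L (IsCMField.complexConj L) 3 H' ((UnitaryGroup.cmDatum L 3 H').toAdelic (Quotient.out c))) v} : Set ↥(UnitaryGroup.localPi L (IsCMField.complexConj L) 3 H' v))))) (fun v => (Measure.map (subgroupCongrHomeomorph (ψ v).symm.toMulEquiv (Subgroup.centralizer ({((UnitaryGroup.cmDatum L 3 H').toLocal v ((UnitaryGroup.cmDatum L 3 H').toAdelic (Quotient.out c)))} : Set ((UnitaryGroup.cmDatum L 3 H').Local v))) (Subgroup.centralizer ({(UnitaryGroup.finAdelicEquiv (↥(maximalRealSubfield L)) L (IsCMField.complexConj L) 3 H') (UnitaryGroup.finPart (↥(maximalRealSubfield L)) L (IsCMField.complexConj L) 3 H' ((UnitaryGroup.cmDatum L 3 H').toAdelic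 (Quotient.out c))) v} : Set ↥(UnitaryGroup.localPi L (IsCMField.complexConj L) 3 H' v))) (UnitaryGroup.localPiEquiv_symm_mem_centralizer_iff L 3 H' v ((UnitaryGroup.cmDatum L 3 H').toAdelic (Quotient.out c)) (ψ v) (congrFun hψ v)) (ψ v).symm.continuous (ψ v).continuous) (tGs₀ v ((UnitaryGroup.cmDatum L 3 H').toLocal v ((UnitaryGroup.cmDatum L 3 H').toAdelic (Quotient.out c)))))) S₀) ∧
                ρM = Measure.map (subgroupCongrHomeomorph (MulEquiv.refl (Πʳ v : HeightOneSpectrum (𝓞 ↥(maximalRealSubfield L)), [↥(UnitaryGroup.localPi L (IsCMField.complexConj L) 3 H' v), UnitaryGroup.localInt L (IsCMField.complexConj L) 3 H' v])) (cutout (fun v => UnitaryGroup.localInt L (IsCMField.complexConj L) 3 H' v) (fun v => (Subgroup.centralizer ({(UnitaryGroup.finAdelicEquiv (↥(maximalRealSubfield L)) L (IsCMField.complexConj L) 3 H') (UnitaryGroup.finPart (↥(maximalRealSubfield L)) L (IsCMField.complexConj L) 3 H' ((UnitaryGroup.cmDatum L 3 H').toAdelic (Quotient.out c))) v} : Set ↥(UnitaryGroup.localPi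 L (IsCMField.complexConj L) 3 H' v))))) (Subgroup.centralizer ({(UnitaryGroup.finAdelicEquiv (↥(maximalRealSubfield L)) L (IsCMField.complexConj L) 3 H') (UnitaryGroup.finPart (↥(maximalRealSubfield L)) L (IsCMField.complexConj L) 3 H' ((UnitaryGroup.cmDatum L 3 H').toAdelic (Quotient.out c)))} : Set (Πʳ v : HeightOneSpectrum (𝓞 ↥(maximalRealSubfield L)), [↥(UnitaryGroup.localPi L (IsCMField.complexConj L) 3 H' v), UnitaryGroup.localInt L (IsCMField.complexConj L) 3 H' v]))) (forall_refl_mem_iff (fun v => UnitaryGroup.localInt L (IsCMField.complexConj L) 3 H' v) (fun v => (Subgroup.centralizer ({(UnitaryGroup.finAdelicEquiv (↥(maximalRealSubfield L)) L (IsCMField.complexConj L) 3 H') (UnitaryGroup.finPart (↥(maximalRealSubfield L)) L (IsCMField.complexConj L) 3 H' ((UnitaryGroup.cmDatum L 3 H').toAdelic (Quotient.out c))) v} : Set ↥(UnitaryGroup.localPi L (IsCMField.complexConj L) 3 H' v)))) _ (mem_centralizer_singleton_iff_forall_mem (fun v => UnitaryGroup.localInt L (IsCMField.complexConj L) 3 H'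 v) ((UnitaryGroup.finAdelicEquiv (↥(maximalRealSubfield L)) L (IsCMField.complexConj L) 3 H') (UnitaryGroup.finPart (↥(maximalRealSubfield L)) L (IsCMField.complexConj L) 3 H' ((UnitaryGroup.cmDatum L 3 H').toAdelic (Quotient.out c)))))) continuous_id continuous_id) ρ ∧
                tf = Measure.map (subgroupCongrHomeomorph (UnitaryGroup.finAdelicEquiv (↥(maximalRealSubfield L)) L (IsCMField.complexConj L) 3 H').symm.toMulEquiv (Subgroup.centralizer ({(UnitaryGroup.finAdelicEquiv (↥(maximalRealSubfield L)) L (IsCMField.complexConj L) 3 H') (UnitaryGroup.finPart (↥(maximalRealSubfield L)) L (IsCMField.complexConj L) 3 H' ((UnitaryGroup.cmDatum L 3 H').toAdelic (Quotient.out c)))} : Set (Πʳ v : HeightOneSpectrum (𝓞 ↥(maximalRealSubfield L)), [↥(UnitaryGroup.localPi L (IsCMField.complexConj L) 3 H' v), UnitaryGroup.localInt L (IsCMField.complexConj L) 3 H' v]))) (Subgroup.centralizer ({(UnitaryGroup.finPart (↥(maximalRealSubfield L)) L (IsCMField.complexConj L) 3 H' ((UnitaryGroup.cmDatum L 3 H').toAdelic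 (Quotient.out c)))} : Set (UnitaryGroup.finAdelic (↥(maximalRealSubfield L)) L (IsCMField.complexConj L) 3 H'))) (forall_apply_mem_centralizer_singleton_iff_of_eq (UnitaryGroup.finAdelicEquiv (↥(maximalRealSubfield L)) L (IsCMField.complexConj L) 3 H').symm.toMulEquiv ((UnitaryGroup.finAdelicEquiv (↥(maximalRealSubfield L)) L (IsCMField.complexConj L) 3 H').symm_apply_apply (UnitaryGroup.finPart (↥(maximalRealSubfield L)) L (IsCMField.complexConj L) 3 H' ((UnitaryGroup.cmDatum L 3 H').toAdelic (Quotient.out c))))) (UnitaryGroup.finAdelicEquiv (↥(maximalRealSubfield L)) L (IsCMField.complexConj L) 3 H').symm.continuous (UnitaryGroup.finAdelicEquiv (↥(maximalRealSubfield L)) L (IsCMField.complexConj L) 3 H').continuous) ρM ∧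
                Measure.map (Subgroup.prodEquiv (Subgroup.centralizer ({UnitaryGroup.archPart (↥(maximalRealSubfield L)) L (IsCMField.complexConj L) 3 H' ((UnitaryGroup.cmDatum L 3 H').toAdelic (Quotient.out c))} : Set (UnitaryGroup.arch (↥(maximalRealSubfield L)) L (IsCMField.complexConj L) 3 H'))) (Subgroup.centralizer ({(UnitaryGroup.finPart (↥(maximalRealSubfield L)) L (IsCMField.complexConj L) 3 H' ((UnitaryGroup.cmDatum L 3 H').toAdelic (Quotient.out c)))} : Set (UnitaryGroup.finAdelic (↥(maximalRealSubfield L)) L (IsCMField.complexConj L) 3 H')))) tP = (Literature.NumberTheory.Weil1964.UnitaryArchTopForm.centralizerTopFormHaar L H' (UnitaryGroup.archPart (↥(maximalRealSubfield L)) L (IsCMField.complexConj L) 3 H' ((UnitaryGroup.cmDatum L 3 H').toAdelic (Quotient.out c)))).prod tf ∧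
                tA c = Measure.map (subgroupCongrHomeomorph e ((Subgroup.centralizer ({UnitaryGroup.archPart (↥(maximalRealSubfield L)) L (IsCMField.complexConj L) 3 H' ((UnitaryGroup.cmDatum L 3 H').toAdelic (Quotient.out c))} : Set (UnitaryGroup.arch (↥(maximalRealSubfield L)) L (IsCMField.complexConj L) 3 H'))).prod (Subgroup.centralizer ({(UnitaryGroup.finPart (↥(maximalRealSubfield L)) L (IsCMField.complexConj L) 3 H' ((UnitaryGroup.cmDatum L 3 H').toAdelic (Quotient.out c)))} : Set (UnitaryGroup.finAdelic (↥(maximalRealSubfield L)) L (IsCMField.complexConj L) 3 H')))) (Subgroup.centralizer ({((UnitaryGroup.cmDatum L 3 H').toAdelic (Quotient.out c))} : Set (UnitaryGroup.cmDatum L 3 H').Adelic)) (forall_apply_mem_centralizer_iff e (hg ((UnitaryGroup.cmDatum L 3 H').toAdelic (Quotient.out c)))) he hes) tP) →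
            ∀ c c' : ConjClasses (UnitaryGroup.cmDatum L 3 H').Rational, ¬ IsRegularElt ((Quotient.out c).val : GL (Fin 3) L) →
              (¬ ∃ ζ : L, (((Quotient.out c).val : GL (Fin 3) L) : Matrix (Fin 3) (Fin 3) L) = ζ • (1 : Matrix (Fin 3) (Fin 3) L)) →
              ¬ IsRegularElt ((Quotient.out c').val : GL (Fin 3) L) →
              (¬ ∃ ζ : L, (((Quotient.out c').val : GL (Fin 3) L) : Matrix (Fin 3) (Fin 3) L) = ζ • (1 : Matrix (Fin 3) (Fin 3) L)) →
              StableClass.ofConjClass c = StableClass.ofConjClass c' →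
              quotientMeasure (((UnitaryGroup.cmDatum L 3 H').quotientSubgroup ⊓
                    Subgroup.centralizer ({(UnitaryGroup.cmDatum L 3 H').toAdelic (Quotient.out c)} : Set (UnitaryGroup.cmDatum L 3 H').Adelic)).subgroupOf
                    (Subgroup.centralizer ({(UnitaryGroup.cmDatum L 3 H').toAdelic (Quotient.out c)} : Set (UnitaryGroup.cmDatum L 3 H').Adelic))) count
                    (isClosed_subgroupOf _ _ ((UnitaryGroup.isClosed_cmDatum_quotientSubgroup L 3 H').inter (hCcl _))) (tA c) Set.univ =
                quotientMeasure (((UnitaryGroup.cmDatum L 3 H').quotientSubgroup ⊓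
                    Subgroup.centralizer ({(UnitaryGroup.cmDatum L 3 H').toAdelic (Quotient.out c')} : Set (UnitaryGroup.cmDatum L 3 H').Adelic)).subgroupOf
                    (Subgroup.centralizer ({(UnitaryGroup.cmDatum L 3 H').toAdelic (Quotient.out c')} : Set (UnitaryGroup.cmDatum L 3 H').Adelic))) count
                    (isClosed_subgroupOf _ _ ((UnitaryGroup.isClosed_cmDatum_quotientSubgroup L 3 H').inter (hCcl _))) (tA c') Set.univ))
    (hAKS :
        ∀ (mGs₀ : ∀ v : HeightOneSpectrum (𝓞 ↥(maximalRealSubfield L)), OrbitalMeasureFamily ((UnitaryGroup.cmDatum L 3 H').Local v))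
          (tGs₀ : ∀ (v : HeightOneSpectrum (𝓞 ↥(maximalRealSubfield L))) (γ : (UnitaryGroup.cmDatum L 3 H').Local v), Measure ↥(Subgroup.centralizer ({γ} : Set ((UnitaryGroup.cmDatum L 3 H').Local v)))),
          -- (Q-fin)₀ VERBATIM
          (∀ v, (mGs₀ v).IsQuotientOf (fun x : (UnitaryGroup.cmDatum L 3 H').Local v => ∃ γ₀ : (UnitaryGroup.cmDatum L 3 H').Rational, ¬ IsRegularElt (γ₀.val : GL (Fin 3) L) ∧
                Corresponds (UnitaryGroup.conjLocal L (IsCMField.complexConj L) v)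
                  ((UnitaryGroup.adelicForm L 3 H').map (UnitaryGroup.adeleToLocal L v))
                  ((UnitaryGroup.adelicForm L 3 H').map (UnitaryGroup.adeleToLocal L v))
                  ((UnitaryGroup.cmDatum L 3 H').toLocal v ((UnitaryGroup.cmDatum L 3 H').toAdelic γ₀)) x) (νG v) (tGs₀ v)) →
          -- (COH-fin)₀ VERBATIM
          (∀ (v : HeightOneSpectrum (𝓞 ↥(maximalRealSubfield L))) (γ₁ γ₂ q : (UnitaryGroup.cmDatum L 3 H').Local v) (hq : (MulAut.conj q : (UnitaryGroup.cmDatum L 3 H').Local v ≃* (UnitaryGroup.cmDatum L 3 H').Local v) γ₁ = γ₂),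
            (∃ γ₀ : (UnitaryGroup.cmDatum L 3 H').Rational, ¬ IsRegularElt (γ₀.val : GL (Fin 3) L) ∧
                Corresponds (UnitaryGroup.conjLocal L (IsCMField.complexConj L) v)
                  ((UnitaryGroup.adelicForm L 3 H').map (UnitaryGroup.adeleToLocal L v))
                  ((UnitaryGroup.adelicForm L 3 H').map (UnitaryGroup.adeleToLocal L v))
                  ((UnitaryGroup.cmDatum L 3 H').toLocal v ((UnitaryGroup.cmDatum L 3 H').toAdelic γ₀)) γ₁) →
            Measure.map (subgroupCongrHomeomorph (MulAut.conj q : (UnitaryGroup.cmDatum L 3 H').Local v ≃* (UnitaryGroup.cmDatum L 3 H').Local v) (Subgroup.centralizer ({γ₁} : Set ((UnitaryGroup.cmDatum L 3 H').Local v)))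
              (Subgroup.centralizer ({γ₂} : Set ((UnitaryGroup.cmDatum L 3 H').Local v))) (forall_apply_mem_centralizer_singleton_iff_of_eq (MulAut.conj q : (UnitaryGroup.cmDatum L 3 H').Local v ≃* (UnitaryGroup.cmDatum L 3 H').Local v) hq)
              (continuous_mulAutConj q) (continuous_mulAutConj_symm q)) (tGs₀ v γ₁) = tGs₀ v γ₂) →
          -- (LEV)₀ VERBATIM
          (∀ γ₀ : (UnitaryGroup.cmDatum L 3 H').Rational, ¬ IsRegularElt (γ₀.val : GL (Fin 3) L) →
            ∀ᶠ v : HeightOneSpectrum (𝓞 ↥(maximalRealSubfield L)) in Filter.cofinite,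
              tGs₀ v ((UnitaryGroup.cmDatum L 3 H').toLocal v ((UnitaryGroup.cmDatum L 3 H').toAdelic γ₀))
                (Subtype.val ⁻¹' (UnitaryGroup.cmLocalIntegralLevel L 3 H' v : Set ((UnitaryGroup.cmDatum L 3 H').Local v))) = 1) →
          -- the κ-block binders VERBATIM; antecedent (κ-loc-Q)[mGs₀] (the letters alone, `∃ c`); conclusion κ-BLOCK-TF[mGs₀] VERBATIM (the organ may re-pick `c`)
          ∀ (γ₀ : (UnitaryGroup.cmDatum L 3 H').Rational) (e₁ e₂ : L), e₁ ≠ e₂ →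
            ((((γ₀ : unitaryGroup (cmConjRingHom L) H').val : GL (Fin 3) L) : Matrix (Fin 3) (Fin 3) L) - e₁ • (1 : Matrix (Fin 3) (Fin 3) L)) * ((((γ₀ : unitaryGroup (cmConjRingHom L) H').val : GL (Fin 3) L) : Matrix (Fin 3) (Fin 3) L) - e₂ • (1 : Matrix (Fin 3) (Fin 3) L)) = 0 →
            (¬ ∃ ζ : L, (((γ₀ : unitaryGroup (cmConjRingHom L) H').val : GL (Fin 3) L) : Matrix (Fin 3) (Fin 3) L) = ζ • (1 : Matrix (Fin 3) (Fin 3) L)) →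
            (((γ₀ : unitaryGroup (cmConjRingHom L) H').val : GL (Fin 3) L) : Matrix (Fin 3) (Fin 3) L).charpoly =
              (Polynomial.X - Polynomial.C e₁) ^ 2 * (Polynomial.X - Polynomial.C e₂) →
            ∀ (γH : (UnitaryGroup.cmDatum L 2 (Matrix.of fun i j : Fin 2 => if i.val + j.val + 1 = 2 then (1 : L) else 0)).Rational ×
                (UnitaryGroup.cmDatum L 1 (Matrix.of fun i j : Fin 1 => if i.val + j.val + 1 = 1 then (1 : L) else 0)).Rational),
              (((γH.1 : unitaryGroup (cmConjRingHom L) (Matrix.of fun i j : Fin 2 => if i.val + j.val + 1 = 2 then (1 : L) else 0)).val : GL (Fin 2) L) : Matrix (Fin 2) (Fin 2) L) =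
                e₁ • (1 : Matrix (Fin 2) (Fin 2) L) →
              (((γH.2 : unitaryGroup (cmConjRingHom L) (Matrix.of fun i j : Fin 1 => if i.val + j.val + 1 = 1 then (1 : L) else 0)).val : GL (Fin 1) L) : Matrix (Fin 1) (Fin 1) L) 0 0 = e₂ →
              (∃ (c : HeightOneSpectrum (𝓞 ↥(maximalRealSubfield L)) → ℂ), (∀ v, c v ≠ 0) ∧
                (∀ (v : HeightOneSpectrum (𝓞 ↥(maximalRealSubfield L)))
                      (fH : (UnitaryGroup.cmDatum L 2 (Matrix.of fun i j : Fin 2 => if i.val + j.val + 1 = 2 then (1 : L) else 0)).Local v × (UnitaryGroup.cmDatum L 1 (Matrix.of fun i j : Fin 1 => if i.val + j.val + 1 = 1 then (1 : L) else 0)).Local v → ℂ) (f : (UnitaryGroup.cmDatum L 3 H').Local v → ℂ),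
                    IsLocSmooth f → IsLocSmooth fH → IsLocalDeltaTransfer L H' v (Δ v) (mH v) (mG v) fH f →
                    localStableOrbitalIntegral L 3 H' v (mGs₀ v) f ((UnitaryGroup.cmDatum L 3 H').toLocal v ((UnitaryGroup.cmDatum L 3 H').toAdelic γ₀)) =
                      c v * fH ((UnitaryGroup.cmDatum L 2 (Matrix.of fun i j : Fin 2 => if i.val + j.val + 1 = 2 then (1 : L) else 0)).toLocal v ((UnitaryGroup.cmDatum L 2 (Matrix.of fun i j : Fin 2 => if i.val + j.val + 1 = 2 then (1 : L) else 0)).toAdelic γH.1),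
                        (UnitaryGroup.cmDatum L 1 (Matrix.of fun i j : Fin 1 => if i.val + j.val + 1 = 1 then (1 : L) else 0)).toLocal v ((UnitaryGroup.cmDatum L 1 (Matrix.of fun i j : Fin 1 => if i.val + j.val + 1 = 1 then (1 : L) else 0)).toAdelic γH.2)))) →
              ∃ (c : HeightOneSpectrum (𝓞 ↥(maximalRealSubfield L)) → ℂ) (cinf : ℂ), (∀ v, c v ≠ 0) ∧ cinf ≠ 0 ∧
                (∀ (v : HeightOneSpectrum (𝓞 ↥(maximalRealSubfield L)))
                      (fH : (UnitaryGroup.cmDatum L 2 (Matrix.of fun i j : Fin 2 => if i.val + j.val + 1 = 2 then (1 : L) else 0)).Local v × (UnitaryGroup.cmDatum L 1 (Matrix.of fun i j : Fin 1 => if i.val + j.val + 1 = 1 then (1 : L) else 0)).Local v → ℂ) (f : (UnitaryGroup.cmDatum L 3 H').Local v → ℂ),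
                    IsLocSmooth f → IsLocSmooth fH → IsLocalDeltaTransfer L H' v (Δ v) (mH v) (mG v) fH f →
                    localStableOrbitalIntegral L 3 H' v (mGs₀ v) f ((UnitaryGroup.cmDatum L 3 H').toLocal v ((UnitaryGroup.cmDatum L 3 H').toAdelic γ₀)) =
                      c v * fH ((UnitaryGroup.cmDatum L 2 (Matrix.of fun i j : Fin 2 => if i.val + j.val + 1 = 2 then (1 : L) else 0)).toLocal v ((UnitaryGroup.cmDatum L 2 (Matrix.of fun i j : Fin 2 => if i.val + j.val + 1 = 2 then (1 : L) else 0)).toAdelic γH.1),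
                        (UnitaryGroup.cmDatum L 1 (Matrix.of fun i j : Fin 1 => if i.val + j.val + 1 = 1 then (1 : L) else 0)).toLocal v ((UnitaryGroup.cmDatum L 1 (Matrix.of fun i j : Fin 1 => if i.val + j.val + 1 = 1 then (1 : L) else 0)).toAdelic γH.2))) ∧
                (∀ (aH : UnitaryGroup.arch (↥(maximalRealSubfield L)) L (IsCMField.complexConj L) 2 (Matrix.of fun i j : Fin 2 => if i.val + j.val + 1 = 2 then (1 : L) else 0) ×
                        UnitaryGroup.arch (↥(maximalRealSubfield L)) L (IsCMField.complexConj L) 1 (Matrix.of fun i j : Fin 1 => if i.val + j.val + 1 = 1 then (1 : L) else 0) → ℂ)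
                      (a : UnitaryGroup.arch (↥(maximalRealSubfield L)) L (IsCMField.complexConj L) 3 H' → ℂ),
                    ArchSmooth L 3 H' a → ArchSmooth₂ L aH → IsArchDeltaTransfer L H' Tinf mHi m' aH a →
                    archStableOrbitalIntegral L 3 H' (Literature.NumberTheory.Weil1964.UnitaryArchTopForm.archSingularTopFormFamily L H' νGi) a (cmRationalToArch L 3 H' γ₀) =
                      cinf * aH (cmRationalToArch L 2 (Matrix.of fun i j : Fin 2 => if i.val + j.val + 1 = 2 then (1 : L) else 0) γH.1, cmRationalToArch L 1 (Matrix.of fun i j : Fin 1 => if i.val + j.val + 1 = 1 then (1 : L) else 0) γH.2)) ∧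
                (∀ S_c : Finset (HeightOneSpectrum (𝓞 ↥(maximalRealSubfield L))), (∀ v ∉ S_c, c v = 1) →
                    ∃ r : ℝ, 0 < r ∧ cinf * ∏ v ∈ S_c, c v = (r : ℂ)))
    :
    ∃ (tGs : ∀ (v : HeightOneSpectrum (𝓞 ↥(maximalRealSubfield L))) (γ : (UnitaryGroup.cmDatum L 3 H').Local v), Measure ↥(Subgroup.centralizer ({γ} : Set ((UnitaryGroup.cmDatum L 3 H').Local v)))),
      -- (HAAR) = ★ p847860's (X1): inversion-invariant Haar partners at the guarded local points
      (∀ (v : HeightOneSpectrum (𝓞 ↥(maximalRealSubfield L))) (x : (UnitaryGroup.cmDatum L 3 H').Local v),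
        (∃ γ₀ : (UnitaryGroup.cmDatum L 3 H').Rational, ¬ IsRegularElt (γ₀.val : GL (Fin 3) L) ∧
            Corresponds (UnitaryGroup.conjLocal L (IsCMField.complexConj L) v)
              ((UnitaryGroup.adelicForm L 3 H').map (UnitaryGroup.adeleToLocal L v))
              ((UnitaryGroup.adelicForm L 3 H').map (UnitaryGroup.adeleToLocal L v))
              ((UnitaryGroup.cmDatum L 3 H').toLocal v ((UnitaryGroup.cmDatum L 3 H').toAdelic γ₀)) x) →
        (tGs v x).IsHaarMeasure ∧ (tGs v x).IsInvInvariant) ∧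
      -- (COH-fin) VERBATIM (= ★ p847860's `hcoh`)
      (∀ (v : HeightOneSpectrum (𝓞 ↥(maximalRealSubfield L))) (γ₁ γ₂ q : (UnitaryGroup.cmDatum L 3 H').Local v) (hq : (MulAut.conj q : (UnitaryGroup.cmDatum L 3 H').Local v ≃* (UnitaryGroup.cmDatum L 3 H').Local v) γ₁ = γ₂),
        (∃ γ₀ : (UnitaryGroup.cmDatum L 3 H').Rational, ¬ IsRegularElt (γ₀.val : GL (Fin 3) L) ∧
            Corresponds (UnitaryGroup.conjLocal L (IsCMField.complexConj L) v)
              ((UnitaryGroup.adelicForm L 3 H').map (UnitaryGroup.adeleToLocal L v))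
              ((UnitaryGroup.adelicForm L 3 H').map (UnitaryGroup.adeleToLocal L v))
              ((UnitaryGroup.cmDatum L 3 H').toLocal v ((UnitaryGroup.cmDatum L 3 H').toAdelic γ₀)) γ₁) →
        Measure.map (subgroupCongrHomeomorph (MulAut.conj q : (UnitaryGroup.cmDatum L 3 H').Local v ≃* (UnitaryGroup.cmDatum L 3 H').Local v) (Subgroup.centralizer ({γ₁} : Set ((UnitaryGroup.cmDatum L 3 H').Local v)))
          (Subgroup.centralizer ({γ₂} : Set ((UnitaryGroup.cmDatum L 3 H').Local v))) (forall_apply_mem_centralizer_singleton_iff_of_eq (MulAut.conj q : (UnitaryGroup.cmDatum L 3 H').Local v ≃* (UnitaryGroup.cmDatum L 3 H').Local v) hq)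
          (continuous_mulAutConj q) (continuous_mulAutConj_symm q)) (tGs v γ₁) = tGs v γ₂) ∧
      -- (LEV) = ★ p847860's `hlev`: level mass one at every non-regular rational point at cofinitely many places [§1.7 p. 6, p. 11; §4.3 p. 44]
      (∀ γ₀ : (UnitaryGroup.cmDatum L 3 H').Rational, ¬ IsRegularElt (γ₀.val : GL (Fin 3) L) →
        ∀ᶠ v : HeightOneSpectrum (𝓞 ↥(maximalRealSubfield L)) in Filter.cofinite,
          tGs v ((UnitaryGroup.cmDatum L 3 H').toLocal v ((UnitaryGroup.cmDatum L 3 H').toAdelic γ₀))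
            (Subtype.val ⁻¹' (UnitaryGroup.cmLocalIntegralLevel L 3 H' v : Set ((UnitaryGroup.cmDatum L 3 H').Local v))) = 1) ∧
      -- (CEN) = ★ p847860's `hcen`: level mass one at the rational scalars at EVERY place [Prop. 10.1.2 (b)]
      (∀ (γ₀ : (UnitaryGroup.cmDatum L 3 H').Rational) (ζ : L), (((γ₀.val : GL (Fin 3) L)) : Matrix (Fin 3) (Fin 3) L) = ζ • (1 : Matrix (Fin 3) (Fin 3) L) →
        ∀ v : HeightOneSpectrum (𝓞 ↥(maximalRealSubfield L)),
          tGs v ((UnitaryGroup.cmDatum L 3 H').toLocal v ((UnitaryGroup.cmDatum L 3 H').toAdelic γ₀))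
            (Subtype.val ⁻¹' (UnitaryGroup.cmLocalIntegralLevel L 3 H' v : Set ((UnitaryGroup.cmDatum L 3 H').Local v))) = 1) ∧
      -- (κ-Q₀) ONE Weil-quotient family `mGs₀` of `νG_v` by `tGs v` ((Q-fin) VERBATIM with `mGs₀`) carrying the κ-BLOCK-TF VERBATIM (with `mGs₀`)
      ∃ (mGs₀ : ∀ v : HeightOneSpectrum (𝓞 ↥(maximalRealSubfield L)), OrbitalMeasureFamily ((UnitaryGroup.cmDatum L 3 H').Local v)),
        (∀ v, (mGs₀ v).IsQuotientOf (fun x : (UnitaryGroup.cmDatum L 3 H').Local v => ∃ γ₀ : (UnitaryGroup.cmDatum L 3 H').Rational, ¬ IsRegularElt (γ₀.val : GL (Fin 3) L) ∧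
            Corresponds (UnitaryGroup.conjLocal L (IsCMField.complexConj L) v)
              ((UnitaryGroup.adelicForm L 3 H').map (UnitaryGroup.adeleToLocal L v))
              ((UnitaryGroup.adelicForm L 3 H').map (UnitaryGroup.adeleToLocal L v))
              ((UnitaryGroup.cmDatum L 3 H').toLocal v ((UnitaryGroup.cmDatum L 3 H').toAdelic γ₀)) x) (νG v) (tGs v)) ∧
        (∀ (γ₀ : (UnitaryGroup.cmDatum L 3 H').Rational) (e₁ e₂ : L), e₁ ≠ e₂ →
        ((((γ₀ : unitaryGroup (cmConjRingHom L) H').val : GL (Fin 3) L) : Matrix (Fin 3) (Fin 3) L) - e₁ • (1 : Matrix (Fin 3) (Fin 3) L)) * ((((γ₀ : unitaryGroup (cmConjRingHom L) H').val : GL (Fin 3) L) : Matrix (Fin 3) (Fin 3) L) - e₂ • (1 : Matrix (Fin 3) (Fin 3) L)) = 0 →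
        (¬ ∃ ζ : L, (((γ₀ : unitaryGroup (cmConjRingHom L) H').val : GL (Fin 3) L) : Matrix (Fin 3) (Fin 3) L) = ζ • (1 : Matrix (Fin 3) (Fin 3) L)) →
        (((γ₀ : unitaryGroup (cmConjRingHom L) H').val : GL (Fin 3) L) : Matrix (Fin 3) (Fin 3) L).charpoly =
          (Polynomial.X - Polynomial.C e₁) ^ 2 * (Polynomial.X - Polynomial.C e₂) →
        ∀ (γH : (UnitaryGroup.cmDatum L 2 (Matrix.of fun i j : Fin 2 => if i.val + j.val + 1 = 2 then (1 : L) else 0)).Rational ×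
            (UnitaryGroup.cmDatum L 1 (Matrix.of fun i j : Fin 1 => if i.val + j.val + 1 = 1 then (1 : L) else 0)).Rational),
          (((γH.1 : unitaryGroup (cmConjRingHom L) (Matrix.of fun i j : Fin 2 => if i.val + j.val + 1 = 2 then (1 : L) else 0)).val : GL (Fin 2) L) : Matrix (Fin 2) (Fin 2) L) =
            e₁ • (1 : Matrix (Fin 2) (Fin 2) L) →
          (((γH.2 : unitaryGroup (cmConjRingHom L) (Matrix.of fun i j : Fin 1 => if i.val + j.val + 1 = 1 then (1 : L) else 0)).val : GL (Fin 1) L) : Matrix (Fin 1) (Fin 1) L) 0 0 = e₂ →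
          ∃ (c : HeightOneSpectrum (𝓞 ↥(maximalRealSubfield L)) → ℂ) (cinf : ℂ), (∀ v, c v ≠ 0) ∧ cinf ≠ 0 ∧
            (∀ (v : HeightOneSpectrum (𝓞 ↥(maximalRealSubfield L)))
                  (fH : (UnitaryGroup.cmDatum L 2 (Matrix.of fun i j : Fin 2 => if i.val + j.val + 1 = 2 then (1 : L) else 0)).Local v × (UnitaryGroup.cmDatum L 1 (Matrix.of fun i j : Fin 1 => if i.val + j.val + 1 = 1 then (1 : L) else 0)).Local v → ℂ) (f : (UnitaryGroup.cmDatum L 3 H').Local v → ℂ),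
                IsLocSmooth f → IsLocSmooth fH → IsLocalDeltaTransfer L H' v (Δ v) (mH v) (mG v) fH f →
                localStableOrbitalIntegral L 3 H' v (mGs₀ v) f ((UnitaryGroup.cmDatum L 3 H').toLocal v ((UnitaryGroup.cmDatum L 3 H').toAdelic γ₀)) =
                  c v * fH ((UnitaryGroup.cmDatum L 2 (Matrix.of fun i j : Fin 2 => if i.val + j.val + 1 = 2 then (1 : L) else 0)).toLocal v ((UnitaryGroup.cmDatum L 2 (Matrix.of fun i j : Fin 2 => if i.val + j.val + 1 = 2 then (1 : L) else 0)).toAdelic γH.1),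
                    (UnitaryGroup.cmDatum L 1 (Matrix.of fun i j : Fin 1 => if i.val + j.val + 1 = 1 then (1 : L) else 0)).toLocal v ((UnitaryGroup.cmDatum L 1 (Matrix.of fun i j : Fin 1 => if i.val + j.val + 1 = 1 then (1 : L) else 0)).toAdelic γH.2))) ∧
            (∀ (aH : UnitaryGroup.arch (↥(maximalRealSubfield L)) L (IsCMField.complexConj L) 2 (Matrix.of fun i j : Fin 2 => if i.val + j.val + 1 = 2 then (1 : L) else 0) ×
                    UnitaryGroup.arch (↥(maximalRealSubfield L)) L (IsCMField.complexConj L) 1 (Matrix.of fun i j : Fin 1 => if i.val + j.val + 1 = 1 then (1 : L) else 0) → ℂ)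
                  (a : UnitaryGroup.arch (↥(maximalRealSubfield L)) L (IsCMField.complexConj L) 3 H' → ℂ),
                ArchSmooth L 3 H' a → ArchSmooth₂ L aH → IsArchDeltaTransfer L H' Tinf mHi m' aH a →
                archStableOrbitalIntegral L 3 H' (Literature.NumberTheory.Weil1964.UnitaryArchTopForm.archSingularTopFormFamily L H' νGi) a (cmRationalToArch L 3 H' γ₀) =
                  cinf * aH (cmRationalToArch L 2 (Matrix.of fun i j : Fin 2 => if i.val + j.val + 1 = 2 then (1 : L) else 0) γH.1, cmRationalToArch L 1 (Matrix.of fun i j : Fin 1 => if i.val + j.val + 1 = 1 then (1 : L) else 0) γH.2)) ∧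
            (∀ S_c : Finset (HeightOneSpectrum (𝓞 ↥(maximalRealSubfield L))), (∀ v ∉ S_c, c v = 1) →
                ∃ r : ℝ, 0 < r ∧ cinf * ∏ v ∈ S_c, c v = (r : ℂ))) := by
  obtain ⟨mGs₀, tGs₀, hQ₀, hcoh₀, hlev₀, hκ₀, -⟩ := href
  classical
  -- (HAAR)₀: print's partners are Haar and inversion invariant at EVERY guard point ((Q-fin)₀ at the representative, (COH-fin)₀ along the conjugation; ★ p848504)
  have hHaar₀ : ∀ (v : HeightOneSpectrum (𝓞 ↥(maximalRealSubfield L))) (x : (UnitaryGroup.cmDatum L 3 H').Local v),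
      (∃ γ₀ : (UnitaryGroup.cmDatum L 3 H').Rational, ¬ IsRegularElt (γ₀.val : GL (Fin 3) L) ∧
          Corresponds (UnitaryGroup.conjLocal L (IsCMField.complexConj L) v)
            ((UnitaryGroup.adelicForm L 3 H').map (UnitaryGroup.adeleToLocal L v))
            ((UnitaryGroup.adelicForm L 3 H').map (UnitaryGroup.adeleToLocal L v))
            ((UnitaryGroup.cmDatum L 3 H').toLocal v ((UnitaryGroup.cmDatum L 3 H').toAdelic γ₀)) x) →
      (tGs₀ v x).IsHaarMeasure ∧ (tGs₀ v x).IsInvInvariant := fun v x hx =>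
    isHaarMeasure_and_isInvInvariant_partner L H' νG v (mGs₀ v) (tGs₀ v) (hQ₀ v) (hcoh₀ v) x hx
  -- THE RESCALING FACTOR `a v x`: the inverse level mass at the local images of the rational scalars, `1` elsewhere
  obtain ⟨a, ha1, haP⟩ : ∃ a : ∀ v : HeightOneSpectrum (𝓞 ↥(maximalRealSubfield L)), (UnitaryGroup.cmDatum L 3 H').Local v → ℝ≥0,
      (∀ (v : HeightOneSpectrum (𝓞 ↥(maximalRealSubfield L))) (x : (UnitaryGroup.cmDatum L 3 H').Local v),
        (¬ ∃ (γ₁ : (UnitaryGroup.cmDatum L 3 H').Rational) (ζ : L), (((γ₁.val : GL (Fin 3) L)) : Matrix (Fin 3) (Fin 3) L) = ζ • (1 : Matrix (Fin 3) (Fin 3) L) ∧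
            x = (UnitaryGroup.cmDatum L 3 H').toLocal v ((UnitaryGroup.cmDatum L 3 H').toAdelic γ₁)) → a v x = 1) ∧
      (∀ (v : HeightOneSpectrum (𝓞 ↥(maximalRealSubfield L))) (x : (UnitaryGroup.cmDatum L 3 H').Local v),
        (∃ (γ₁ : (UnitaryGroup.cmDatum L 3 H').Rational) (ζ : L), (((γ₁.val : GL (Fin 3) L)) : Matrix (Fin 3) (Fin 3) L) = ζ • (1 : Matrix (Fin 3) (Fin 3) L) ∧
            x = (UnitaryGroup.cmDatum L 3 H').toLocal v ((UnitaryGroup.cmDatum L 3 H').toAdelic γ₁)) →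
          (a v x : ℝ≥0∞) * tGs₀ v x (Subtype.val ⁻¹' (UnitaryGroup.cmLocalIntegralLevel L 3 H' v : Set ((UnitaryGroup.cmDatum L 3 H').Local v))) = 1) := by
    refine ⟨fun v x => if (∃ (γ₁ : (UnitaryGroup.cmDatum L 3 H').Rational) (ζ : L), (((γ₁.val : GL (Fin 3) L)) : Matrix (Fin 3) (Fin 3) L) = ζ • (1 : Matrix (Fin 3) (Fin 3) L) ∧
            x = (UnitaryGroup.cmDatum L 3 H').toLocal v ((UnitaryGroup.cmDatum L 3 H').toAdelic γ₁)) then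
          ((tGs₀ v x (Subtype.val ⁻¹' (UnitaryGroup.cmLocalIntegralLevel L 3 H' v : Set ((UnitaryGroup.cmDatum L 3 H').Local v)))).toNNReal)⁻¹ else 1,
      fun v x hx => if_neg hx, fun v x hx => ?_⟩
    obtain ⟨γ₁, ζ, hζ, rfl⟩ := hx
    -- `(ζ•1)_v` is a guard point (a rational scalar is non-regular; `↔` is reflexive), so `tGs₀ v (ζ•1)_v` is a Haar measure: `0 < mass(Z ∩ K_v) < ∞`
    obtain ⟨hH, -⟩ := hHaar₀ v _ (not_isRegularElt_and_corresponds_self L H' v γ₁ (not_isRegularElt_of_coe_eq_smul_one γ₁ hζ))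
    haveI := hH
    obtain ⟨h0, htop⟩ := measure_preimage_level_pos_lt_top L H' v _ (tGs₀ v ((UnitaryGroup.cmDatum L 3 H').toLocal v ((UnitaryGroup.cmDatum L 3 H').toAdelic γ₁)))
    have hne : (tGs₀ v ((UnitaryGroup.cmDatum L 3 H').toLocal v ((UnitaryGroup.cmDatum L 3 H').toAdelic γ₁))
        (Subtype.val ⁻¹' (UnitaryGroup.cmLocalIntegralLevel L 3 H' v : Set ((UnitaryGroup.cmDatum L 3 H').Local v)))).toNNReal ≠ 0 := by
      rw [Ne, ENNReal.toNNReal_eq_zero_iff, not_or]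
      exact ⟨h0.ne', htop.ne⟩
    beta_reduce
    rw [if_pos ⟨γ₁, ζ, hζ, rfl⟩, ENNReal.coe_inv hne, ENNReal.coe_toNNReal htop.ne, ENNReal.inv_mul_cancel h0.ne' htop.ne]
  -- `a v x ≠ 0` everywhere
  have ha0 : ∀ (v : HeightOneSpectrum (𝓞 ↥(maximalRealSubfield L))) (x : (UnitaryGroup.cmDatum L 3 H').Local v), a v x ≠ 0 := by
    intro v x h0
    by_cases hx : ∃ (γ₁ : (UnitaryGroup.cmDatum L 3 H').Rational) (ζ : L), (((γ₁.val : GL (Fin 3) L)) : Matrix (Fin 3) (Fin 3) L) = ζ • (1 : Matrix (Fin 3) (Fin 3) L) ∧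
        x = (UnitaryGroup.cmDatum L 3 H').toLocal v ((UnitaryGroup.cmDatum L 3 H').toAdelic γ₁)
    · have h1 := haP v x hx
      rw [h0, ENNReal.coe_zero, zero_mul] at h1
      exact zero_ne_one h1
    · exact one_ne_zero ((ha1 v x hx).symm.trans h0)
  -- THE REPAIRED SYSTEM: partners `a v x • tGs₀ v x`, members `(a v (out c))⁻¹ • mGs₀ v c` (Weil's rule `dν ∕ d(a·t) = a⁻¹ · dν ∕ dt`)
  refine ⟨fun v x => a v x • tGs₀ v x, ?_, ?_, ?_, ?_, fun v cl => (a v (Quotient.out cl))⁻¹ • mGs₀ v cl, ?_, ?_⟩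
  · -- (HAAR): positive multiples of Haar ∕ inversion-invariant measures
    intro v x hx
    obtain ⟨hH, hI⟩ := hHaar₀ v x hx
    haveI := hH
    haveI := hI
    exact ⟨IsHaarMeasure.nnreal_smul _ (ha0 v x), isInvInvariant_nnreal_smul _ _⟩
  · -- (COH-fin): a rational-scalar image is central (its conjugates are itself, and the predicate is conjugation-stable); elsewhere (COH-fin)₀
    intro v γ₁ γ₂ q hq hγ₁
    dsimp only
    by_cases hP : ∃ (γ₃ : (UnitaryGroup.cmDatum L 3 H').Rational) (ζ : L), (((γ₃.val : GL (Fin 3) L)) : Matrix (Fin 3) (Fin 3) L) = ζ • (1 : Matrix (Fin 3) (Fin 3) L) ∧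
        γ₁ = (UnitaryGroup.cmDatum L 3 H').toLocal v ((UnitaryGroup.cmDatum L 3 H').toAdelic γ₃)
    · obtain ⟨γ₃, ζ, hζ, rfl⟩ := hP
      have he : γ₂ = (UnitaryGroup.cmDatum L 3 H').toLocal v ((UnitaryGroup.cmDatum L 3 H').toAdelic γ₃) := by
        rw [← hq, MulAut.conj_apply]
        exact conj_toLocal_eq_of_coe_eq_smul_one L H' v γ₃ hζ q
      subst he
      rw [Measure.map_smul, hcoh₀ v _ _ q hq hγ₁]
    · have hP₂ : ¬ ∃ (γ₃ : (UnitaryGroup.cmDatum L 3 H').Rational) (ζ : L), (((γ₃.val : GL (Fin 3) L)) : Matrix (Fin 3) (Fin 3) L) = ζ • (1 : Matrix (Fin 3) (Fin 3) L) ∧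
          γ₂ = (UnitaryGroup.cmDatum L 3 H').toLocal v ((UnitaryGroup.cmDatum L 3 H').toAdelic γ₃) := by
        rintro ⟨γ₃, ζ, hζ, h₂⟩
        refine hP ⟨γ₃, ζ, hζ, eq_toLocal_of_conj_eq_toLocal_of_coe_eq_smul_one L H' v γ₃ hζ γ₁ q ?_⟩
        rw [← h₂, ← hq, MulAut.conj_apply]
      rw [ha1 v γ₁ hP, ha1 v γ₂ hP₂, one_smul, one_smul]
      exact hcoh₀ v γ₁ γ₂ q hq hγ₁
  · -- (LEV): wherever (LEV)₀ gives level mass one, `a v = 1`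
    intro γ₀ hγ₀
    filter_upwards [hlev₀ γ₀ hγ₀] with v hv
    rw [Measure.smul_apply, ENNReal.smul_def, smul_eq_mul]
    by_cases hP : ∃ (γ₁ : (UnitaryGroup.cmDatum L 3 H').Rational) (ζ : L), (((γ₁.val : GL (Fin 3) L)) : Matrix (Fin 3) (Fin 3) L) = ζ • (1 : Matrix (Fin 3) (Fin 3) L) ∧
        (UnitaryGroup.cmDatum L 3 H').toLocal v ((UnitaryGroup.cmDatum L 3 H').toAdelic γ₀) = (UnitaryGroup.cmDatum L 3 H').toLocal v ((UnitaryGroup.cmDatum L 3 H').toAdelic γ₁)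
    · exact haP v _ hP
    · rw [ha1 v _ hP, hv, ENNReal.coe_one, one_mul]
  · -- (CEN): the inverse level mass times the level mass
    intro γ₀ ζ hζ v
    rw [Measure.smul_apply, ENNReal.smul_def, smul_eq_mul]
    exact haP v _ ⟨γ₀, ζ, hζ, rfl⟩
  · -- (Q-fin) for the repaired system: Weil's rule `dν ∕ d(a·t) = a⁻¹ · dν ∕ dt` (★ `quotientMeasure_eq_inv_smul_of_eq_smul`)
    intro v cl hcl
    obtain ⟨hH, hI, hq⟩ := (OrbitalMeasureFamily.isQuotientOf_iff _ _ _ _).1 (hQ₀ v) cl hcl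
    haveI := hH
    haveI := hI
    haveI hH' : (a v (Quotient.out cl) • tGs₀ v (Quotient.out cl)).IsHaarMeasure := IsHaarMeasure.nnreal_smul _ (ha0 v _)
    haveI hI' : (a v (Quotient.out cl) • tGs₀ v (Quotient.out cl)).IsInvInvariant := isInvInvariant_nnreal_smul _ _
    refine ⟨hH', hI', ?_⟩
    dsimp only
    rw [hq]
    haveI : IsClosed ((Subgroup.centralizer ({(Quotient.out cl : (UnitaryGroup.cmDatum L 3 H').Local v)} : Set ((UnitaryGroup.cmDatum L 3 H').Local v)) :
        Subgroup ((UnitaryGroup.cmDatum L 3 H').Local v)) : Set ((UnitaryGroup.cmDatum L 3 H').Local v)) := isClosed_coe_centralizer_singleton _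
    exact (quotientMeasure_eq_inv_smul_of_eq_smul _ (νG v) (tGs₀ v (Quotient.out cl)) (a v (Quotient.out cl) • tGs₀ v (Quotient.out cl))
      (a v (Quotient.out cl)) (ha0 v _) rfl).symm
  · -- κ-BLOCK-TF: ARCH-κ-SIGN∀ on print's system `(mGs₀, tGs₀)` fed with (κ-loc-Q)₀, then transport of (κ-loc) to the repaired members class by class
    intro γ₀ e₁ e₂ hne hmul hnc hchar γH hγH1 hγH2
    obtain ⟨c, cinf, hc, hcinf, hloc, harch, hsign⟩ :=
      hAKS mGs₀ tGs₀ hQ₀ hcoh₀ hlev₀ γ₀ e₁ e₂ hne hmul hnc hchar γH hγH1 hγH2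
        (hκ₀ γ₀ e₁ e₂ hne hmul hnc hchar γH hγH1 hγH2)
    refine ⟨c, cinf, hc, hcinf, fun v fH f hf hfH htr => ?_, harch, hsign⟩
    -- the letters read the members only on the classes `↔ (γ₀)_v`; none of them is a rational-scalar image (else `γ₀ = ζ•1`), so `a = 1` there
    have key : localStableOrbitalIntegral L 3 H' v (fun cl => (a v (Quotient.out cl))⁻¹ • mGs₀ v cl) f
          ((UnitaryGroup.cmDatum L 3 H').toLocal v ((UnitaryGroup.cmDatum L 3 H').toAdelic γ₀)) =
        localStableOrbitalIntegral L 3 H' v (mGs₀ v) f ((UnitaryGroup.cmDatum L 3 H').toLocal v ((UnitaryGroup.cmDatum L 3 H').toAdelic γ₀)) := by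
      refine stableOrbitalIntegralRel_congr_measure _ (fun cl hcl => ?_) f
      have hnP : ¬ ∃ (γ₁ : (UnitaryGroup.cmDatum L 3 H').Rational) (ζ : L), (((γ₁.val : GL (Fin 3) L)) : Matrix (Fin 3) (Fin 3) L) = ζ • (1 : Matrix (Fin 3) (Fin 3) L) ∧
          Quotient.out cl = (UnitaryGroup.cmDatum L 3 H').toLocal v ((UnitaryGroup.cmDatum L 3 H').toAdelic γ₁) := by
        rintro ⟨γ₁, ζ, hζ, hcl₁⟩
        exact hnc ⟨ζ, coe_eq_smul_one_of_isStablyConj_toLocal_of_coe_eq_smul_one L H' v γ₀ γ₁ hζ hcl hcl₁⟩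
      show (a v (Quotient.out cl))⁻¹ • mGs₀ v cl = mGs₀ v cl
      rw [ha1 v _ hnP, inv_one, one_smul]
    exact key.trans (hloc v fH f hf hfH htr)


end Frame

end Literature.NumberTheory.Rogawski1990

end
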